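import Mathlib
import HarnessLib
import HarnessLib.Audit
import Summits.MatrixMultiplication.Statement
import Literature.Computability.AlgebraicComplexity.MatrixMultiplicationExponent
import Literature.Computability.AlgebraicComplexity.AsymptoticSpectrum
import Literature.Computability.AlgebraicComplexity.TensorSemiring
import Literature.Computability.AlgebraicComplexity.TensorSemiringSpectrum
import Literature.Computability.AlgebraicComplexity.StrassenPreorder
import Literature.Computability.AlgebraicComplexity.BorderRankCW
import Literature.Barriers.MatrixMultiplication.UniversalMethodBarrier
import Summits.MatrixMultiplication.MatrixMultiplication.Theorems.HessianPlaneCWPointAssembly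
import HarnessLib.Audit.Status.Attr

/-!
Route: TripartitionBridge

DORMANT since 2026-08-22T18:31:10Z (reconciler: no traction for 5.6 d (last activity item-evidence-added at 2026-08-17T04:22:18Z); parked, not closed — `ledger route dormant route-MatrixMultiplication-TripartitionBridge --off` to reacti) — unstaffed, not closed; items shared with open routes are served there. `ledger route dormant <id> --off` reactivates.

# Route TripartitionBridge — cw_2 versus Pratt's balanced tripartition tensors at the entropy rate
kappa: omega = 2 through a reversible host, a 3.31 record on the way, or the Set Cover price of
route B

Realises idea card cw2-tripartition-scc-bridge. Write cw_2 = `cwTensor ℂ 2` (the small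
Coppersmith–Winograd tensor; over ℂ it is Pratt's
T_1 = the S_3 permutation tensor), W = `cwTensor ℂ 1`, and T_k = Pratt's balanced tripartition
tensor (Pratt2024 Def 1.4: X_S Y_T Z_U over
k-subsets S, T, U partitioning [3k]; inlined on the index type {A : Finset (Fin (3k)) // |A| = k};
it is the weight-(k,k,k) zeroing of W^(3k)),
N_k = C(3k,k) = (27/4)^(k(1-o(1))), kappa = log(27/4)/log 3 = 1.7381. Every known universal spectral
point (quantum = support functionals)
reads 3 on cw_2 and N_k on T_k, so cw_2^p and T_k^q are spectrally indistinguishable exactly when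
3^p = N_k^q. X = X1 ∧ X2 with
X1 = DUp: T_k-powers asymptotically restrict to cw_2-powers at that rate (cw_2^p ≲ T_k^q whenever
3^p ≤ N_k^q, all k), and
X2 = TkMinimal: lim inf_k R~(T_k)^(1/k) = 27/4 (T_k is an asymptotically REVERSIBLE host). Then
R~(cw_2) ≤ R~(T_k)^(1/log_3 N_k) → 3,
i.e. route B's thesis BThesis (R~(cw_2) = 3), and omega = 2 by the proved CW90 bound. The same
comparison read downwards (DDown, crux 4)
is the negative side: with Pratt2024 Cor 1.11 (Set Cover Conjecture ⇒ R~(T_k) > (8-ε)^k eventually)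
it forces R~(cw_2) ≥ 8^(1/kappa) = 3.3085 > 3
and refutes BThesis conditionally; and either direction alone is decisive for route B: ¬DUp or ¬DUpW
already exhibits a spectral point > 3 at cw_2.
Lean: `(∀ k p q : ℕ, 3 ^ p ≤ (Nat.choose (3 * k) k) ^ q →
Literature.Computability.AlgebraicComplexity.AsympLe (fun x y :
Literature.Computability.AlgebraicComplexity.TensorClass ℂ => x ≤ y)
((Literature.Computability.AlgebraicComplexity.TensorClass.mk
(Literature.Computability.AlgebraicComplexity.cwTensor ℂ 2)) ^ p)
((Literature.Computability.AlgebraicComplexity.TensorClass.mk (fun S T U : {A : Finset (Fin (3 * k))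
// A.card = k} => if Disjoint S.1 T.1 ∧ Disjoint S.1 U.1 ∧ Disjoint T.1 U.1 then (1 : ℂ) else 0)) ^
q)) ∧ (∀ δ : ℝ, 0 < δ → ∀ k₀ : ℕ, ∃ k : ℕ, k₀ ≤ k ∧
Literature.Computability.AlgebraicComplexity.asymptoticRank (fun S T U : {A : Finset (Fin (3 * k))
// A.card = k} => if Disjoint S.1 T.1 ∧ Disjoint S.1 U.1 ∧ Disjoint T.1 U.1 then (1 : ℂ) else 0) ≤
((27 : ℝ) / 4 + δ) ^ k)`

## Assembly
DUp and TkMinimal give BThesis (GlueOmega: host transfer at the entropy-matching rate plus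
reversibility of the host), and BThesis gives
omega(ℂ) = 2 by the Coppersmith–Winograd 1990 easy bound in asymptotic-rank form, PROVED in tree
(`CoppersmithWinograd1990_asymptoticRank_form_holds`,
q = 2, ρ = 3: omega ≤ log_2 4 = 2) with `omega_two_le` (GlueCW90 = route AsymptoticRankCW's assembly
item, shared). Pure composition of the two glue items.

Rationale: WHY THIS LINE. Mechanism (card cw2-tripartition-scc-bridge, sharpened): a HOST TRANSFER in
Strassen's asymptotic spectrum — for any host s, "cw_2^p ≲ s^r whenever
3^p ≤ Q~(s)^r" gives R~(cw_2) ≤ 3^(i(s)) with i(s) = log R~(s)/log Q~(s) the CVZ irreversibility, so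
a record needs any host with 3^(i(s)) < 3.931
(AlmanLi2026) and omega = 2 needs a reversible one; Pratt's T_k (Pratt2024, BjorklundKaski2024; =
Kaski–Michalek type classes T(g) of W-powers,
arXiv:2404.06427 Ex. 11 for T_1 = cw_2) are the natural hosts because they carry ALL the asymptotic
subrank of W^(3k) (Q~(W)^3 = 2^(3h(1/3)) = 27/4,
ChristandlVranaZuiddam2023) and their reversibility is exactly the fine-grained question SCC decides
(Pratt2024 Thm 1.9 / Cor 1.11). Imported:
Strassen's spectral theorem and duality, PROVED in tree for `TensorClass ℂ`
(`IsStrassenPreorder.asympLe_iff_forall_spectralPoint`,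
`strassen_duality_asymptoticRank_holds`, `asympRankOf_mk`), which make every crux a clean dichotomy
(holds, or a dark spectral point exists);
fine-grained complexity (SCC) only as the price tag, never as a hypothesis of the positive assembly.
What prior routes do not do: route
AsymptoticRankCW attacks R~(cw_2) = 3 head-on through Kronecker powers of the 3x3x3 tensor (bR of
squares/cubes); here the small tensor is traded
for the S_(3k)-symmetric 84-, 495-, ...-dimensional hosts, where zeroing/laser technology and
Johnson-scheme symmetry have room to act, and a
single k (k = 4: T_4^5 ≳ cw_2^28) already beats 3.931. Negatives index: empty at filing.

RANKED CRUXES. #2 DUp (crux) — Card item D-up. For all k, p, q with 3^p ≤ C(3k,k)^q, cw_2^(⊠p) ≲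
T_k^(⊠q) in Strassen's asymptotic preorder on `TensorClass ℂ` (there is a subexponential f with
(cw_2^p)^N ≤ f(N)·(T_k^q)^N, ≤ = restriction). Equivalent (spectral theorem, in tree) to: every
universal spectral point φ has φ(cw_2) ≤ 3^(log φ(T_k)/log C(3k,k)). Known: the rate-1 zeroing T_k ≥
cw_2^(⊠k); BThesis ⇒ DUp; DUp(k) ⇒ R~(cw_2) ≤ R~(T_k)^(1/log_3 C(3k,k)) (k = 4 with R(T_4) ≤ 2048: ≤
3.86 < 3.931; k → ∞ with 8^k: 3.3085). [difficulty: XL] (why it might fail: Needs an asymptotic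
degeneration invisible to all known spectral points: if some universal spectral point is dark at
cw_2 (φ(cw_2) > 3, i.e. R~(cw_2) > 3 = ¬BThesis) DUp fails for every k ≥ 2; nothing beyond the
rate-1 zeroing T_k ≥ cw_2^k is known.) [Pratt2024, arXiv:2311.02774, ChristandlVranaZuiddam2023,
Strassen1988, Strassen1991, AlmanLi2026, arXiv:2404.06427]
#3 TkMinimal (crux) — Card fact/upper side. The balanced tripartition tensors are asymptotically
minimal along a subsequence: for every δ > 0 and k0 there is k ≥ k0 with R~(T_k) ≤ (27/4 + δ)^k,
i.e. lim inf R~(T_k)^(1/k) = 27/4 (the flattening lower bound is C(3k,k) = (27/4)^(k(1-o(1)))).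
Implied by Strassen's asymptotic rank conjecture for the tight concise T_k; it is the reversibility
i(T_k) → 1 that the positive assembly needs, and it refutes the Set Cover Conjecture (contrapositive
of Pratt2024 Cor 1.11, via Thm 1.9's (R~(T_k)+ε)·27^k/(C(3k,k)C(2k,k)))^(n/k) tripartitioning
algorithm). [difficulty: open-problem] (why it might fail: SCC forbids it: Pratt2024 Cor 1.11 gives
R~(T_k) > (8-ε)^k for all large k under the Set Cover Conjecture; unconditionally only R(T_k) ≤
8^k/2 is known (so the bound holds for k ≤ 4, as 8^k/2 ≤ (27/4)^k there, and is open from k = 5).)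
[Pratt2024, arXiv:2311.02774, BjorklundKaski2024, arXiv:2404.06427, Strassen1988]
#4 DDown (crux) — Card item D-down (negative side; staffed for the SCC price). For all k, p, q with
C(3k,k)^q ≤ 3^p, T_k^(⊠q) ≲ cw_2^(⊠p) asymptotically. Equivalent to: every universal spectral point
has φ(T_k) ≤ C(3k,k)^(log_3 φ(cw_2)); since φ(cw_2) ≥ Q~(cw_2) = 3, ¬DDown(k) exhibits φ(T_k) >
C(3k,k) = dim, i.e. the first counterexample (tight, concise) to Strassen's asymptotic rank
conjecture. With SccPrice: DDown ∧ [R~(T_k) > (8-ε)^k eventually] ⇒ R~(cw_2) ≥ 8^(1/kappa) = 3.3085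
> 13/4 > 3, refuting BThesis and BRecordThreshold of route AsymptoticRankCW under SCC. [difficulty:
XL] (why it might fail: ¬DDown(k) is exactly a universal spectral point exceeding C(3k,k) at T_k
(ARC false at T_k), which SCC believers expect (R~(T_k) ≈ 8^k forces dark points at T_k); and DDown
∧ SCC ∧ BThesis is contradictory, so one of three widely held expectations dies here.) [Pratt2024,
arXiv:2311.02774, Strassen1988, ChristandlVranaZuiddam2023, arXiv:2601.21553, BjorklundKaski2024]
#5 DUpW (crux) — The W-host form of D-up (weakest statement with the record payoff): for all p, r
with 27^p·4^r ≤ 27^r (i.e. 3^p ≤ Q~(W)^r = (27/4)^(r/3)), cw_2^(⊠p) ≲ W^(⊠r), W = cwTensor ℂ 1.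
Known only at rate p/r = 1/3 (cw_2^(⊠k) is the weight-(k,k,k)-transversal zeroing of W^(⊠3k)); asked
at rate kappa/3 = 0.5794. BThesis ⇒ DUpW ⇒ R~(cw_2) ≤ 2^(3/kappa) = 3.3085 (GlueRecord); ¬DUpW ⇒ a
spectral point with φ(cw_2) > 3 ⇒ ¬BThesis. Host W is irreversible (i(W) = log 8/log(27/4) =
1.0889), so this crux can never certify omega = 2 — it is the record/kill instrument. [difficulty:
XL] (why it might fail: Same darkness obstruction as DUp (any φ(cw_2) > 3 kills it at large r); it
asks for kappa = 1.738 times the only known (zeroing) rate, and for the 2x2x2 host W every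
asymptotic restriction to date is a zeroing or a laser-type monomial degeneration.)
[ChristandlVranaZuiddam2021, ChristandlVranaZuiddam2023, AlmanLi2026, arXiv:2605.21738, Zuiddam2018]
#6 FirstLayerDegeneration (crux) — Card computation item (least non-trivial single-shot instance):
T_3 (dimension C(9,3) = 84) degenerates (Alman's polynomial degeneration `PolyDegeneratesTo`,
formats may differ) to cw_2^(⊠4) (dimension 81). (k, m) = (3, 4) is the first pair with m > k
allowed by flattening rank (k = 2: 15 < 27); a combinatorial/toric solution is a finite search (kit
SAT/LP over maps [81] → C([9],3)), and any solution tensorises to the rate-4/3 instance of DUp.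
[difficulty: L] (why it might fail: Single-shot with no slack (84 vs 81 = 3^4): orbit-closure
invariants may obstruct although the asymptotic DUp holds (cf. bR(cw_2^⊠2) = 16 multiplicative,
ConnerHuangLandsberg2020); e.g. bR(T_3) < bR(cw_2^⊠4) (≥ 3^4+2^4-1 = 96, CGLV Thm 1.2) would kill it
— bR(T_3) ≤ 256 is all that is known.) [Pratt2024, ConnerGesmundoLandsbergVentura2022,
ConnerHuangLandsberg2020, Alman2021]
#9 CwTwoIsTOne (support) — Over ℂ the small Coppersmith–Winograd tensor and Pratt's T_1 (the S_3
permutation tensor) have the same class in `TensorClass ℂ` (mutual restriction; in fact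
GL-equivalent via e_1 ± i·e_2 in each factor: x_0(y_1 z_1 + y_2 z_2) + … = (1/2)·Σ_σ X_σ(1) Y_σ(2)
Z_σ(3)). Pratt2024 §1.2 remark ("T_1 arose in work of Coppersmith and Winograd"); arXiv:2404.06427
Ex. 11. Lets every prover replace cw_2 by T_1 and work inside W-powers. [difficulty: provable-now]
[Pratt2024, arXiv:2404.06427, ConnerGesmundoLandsbergVentura2022]
#9 GlueOmega (support) — Positive glue: DUp → TkMinimal → BThesis (route AsymptoticRankCW's target,
signature verbatim: R(cw_2^(⊗N)) = O(3^((1+ε)N))). Proof sketch: DUp(k,p,q) and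
monotonicity/multiplicativity of R~ on `TensorClass` (`asympRankOf_mk`,
`asympRankOf_mono_of_asympLe`) give R~(cw_2)^p ≤ R~(T_k)^q for 3^p ≤ C(3k,k)^q, hence R~(cw_2) ≤
R~(T_k)^(1/log_3 C(3k,k)); TkMinimal and C(3k,k) ≥ (27/4)^k/(3k+1) give R~(cw_2) ≤ 3; then inf-form
→ growth form (Fekete, as in route B's BPerm3Form ingredients). [difficulty: M] [Strassen1988,
Zuiddam2018, Pratt2024]
#9 GlueCW90 (support) — BThesis → omega = 2: identical to route AsymptoticRankCW's assembly item
(stmt-MatrixMultiplication-0589; filed verbatim so the item is shared). Provable now: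
`CoppersmithWinograd1990_asymptoticRank_form_holds` (q = 2, ρ = 3) gives omega(ℂ) ≤ log_2(4·27/27) =
2, and `omega_two_le`. [difficulty: provable-now] [CoppersmithWinograd1990, Blaser2013,
ConnerGesmundoLandsbergVentura2022]
#9 GlueRecord (support) — Record payoff of the W-host crux: DUpW → R~(cw_2) ≤ 331/100 (exact
constant 2^(3/kappa) = 8^(log 3/log(27/4)) = 3.30805 < 3.31 < 3.931 = AlmanLi2026 Thm 1.3). Uses
R~(W) ≤ 2 (bR(W) = 2 + Bini, `SchoenhageTauBini`), multiplicativity R~(t^(⊠r)) = R~(t)^r and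
monotonicity of R~ under ≲ on `TensorClass ℂ`. [difficulty: M] [AlmanLi2026, arXiv:2605.21738,
ChristandlVranaZuiddam2021, Blaser2013]
#9 RecordWindowK4 (support) — The smallest record window: if R(T_4) ≤ 2048 (Pratt2024 §1.2: R(T_k) ≤
8^k/2 via the structure tensor of Z_2^(3k-1), char ≠ 2) and the single DUp instance (k, p, q) = (4,
28, 5) holds (3^28 = 2.29e13 ≤ 495^5 = 2.97e13), then R~(cw_2) ≤ 2048^(5/28) = 3.9022 ≤ 393/100 <
3.931 (AlmanLi2026). Documents that ONE asymptotic restriction T_4^(⊠5) ≳ cw_2^(⊠28) between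
explicit tensors beats the current record. [difficulty: M] [Pratt2024, AlmanLi2026,
arXiv:2605.21738]
#9 SccPrice (support) — Negative glue (the SCC price tag of route AsymptoticRankCW): DDown →
[Pratt2024 Cor 1.11's conclusion, taken as hypothesis until SCC and Pratt's theorem are vendored: ∀
ε > 0, eventually R~(T_k) > (8-ε)^k] → ¬BThesis. Proof sketch: DDown(k,p,q) gives R~(T_k)^q ≤
R~(cw_2)^p for C(3k,k)^q ≤ 3^p, so R~(T_k) ≤ R~(cw_2)^(log_3 C(3k,k)) ≤ R~(cw_2)^(kappa·k); with the
hypothesis R~(cw_2) ≥ (8-ε)^(1/kappa) → 3.3085 > 3, while BThesis gives R~(cw_2) ≤ 3. [difficulty: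
M] [Pratt2024, arXiv:2311.02774, BjorklundKaski2024]

TWO-LAYER PLAN. Foreseen glued splits, filed only after a crux closes or stalls with a census: DUp ⇐
DUpFinite → DUpAmplify → DUp, with DUpFinite = "for
infinitely many k some single-shot degeneration T_k ⊵ cw_2^(⊠m_k) with m_k/log_3 C(3k,k) → 1" and
DUpAmplify = the tensor-power/supermultiplicativity
bookkeeping (T_(k+k') ≥ T_k ⊠ T_k' by zeroing); TkMinimal ⇐ (rank of T_k through abelian-group
structure tensors beyond Z_2^(3k-1), Pratt's remark) →
(amplification); DDown ⇐ (laser-type degeneration of cw_2^(⊠n) onto the weight-(k,k,k) layer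
structure) → (glue). FirstLayerDegeneration may be split
into "combinatorial degeneration exists (kit certificate)" → "certificate ⇒ PolyDegeneratesTo".

KILL CRITERIA. ¬DUp(k) or ¬DUpW for any single instance is a universal spectral point > 3 at cw_2:
it closes this route (refuted: DUp) AND refutes route
AsymptoticRankCW's thesis — file the witness as a Theorems refutation of both. ¬TkMinimal proved
(e.g. an unconditional R~(T_k) ≥ (27/4+δ)^k for
all large k, a dark point at T_k) closes the positive assembly; the route then pivots to its
negative side (DDown + SccPrice) as a conditional
bridge "SCC ⇒ ¬BThesis", or closes `refuted:TkMinimal` if DDown is also dead. omega > 2 (route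
BorderRankLowerBound) moots the positive side.
BThesis proved elsewhere moots DUp/DUpW (they follow) but not DDown.

NOT DECOMPOSED YET. No construction steps are filed: which degeneration technology (laser zeroing on
W^(3k), toric layer maps, Johnson-scheme/S_(3k) recoupling,
Kaski–Michalek composition-basis calculus) realises DUp is the provers' choice; the conversions
inf-form ↔ growth-form of R~, Q~(cw_2) = 3 and
Q~(T_k) = C(3k,k) (Strassen1991 / CW uniquely-solvable-puzzle zeroings), R~(W) = 2, and the
vendoring of SCC + Pratt2024 Thm 1.9/Cor 1.11 as
Literature named facts are layer-2 support, requested below. No target item is filed: X is literally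
DUp ∧ TkMinimal.

CHEAPEST FALSIFIER. For the LINE: a kit search showing that no COMBINATORIAL degeneration (support
map [81]^3 → C([9],3)^3 in the sense of Bürgisser–Clausen–Shokrollahi
§15.6) realises FirstLayerDegeneration, followed by the same at (k, m) = (4, 5), would show the
card's proposed toolbox (zeroings + toric layer maps)
cannot even start, leaving DUp to genuinely new degenerations; for the STATEMENTS: any universal
spectral point beyond the quantum functionals
evaluated on cw_2 (none is known over ℂ; arXiv:2601.21553 shows support functionals add nothing), or
an unconditional R~(T_5) > 14013 = (27/4)^5
lower bound. Not run here (hub is compute-free; no kit job filed at open).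

NUMBERS. kappa = log(27/4)/log 3 = 1.73814; 8^(1/kappa) = 2^(3/kappa) = 3^(log 8/log 6.75) =
3.30805; i(W) = log 8/log(27/4) = 1/h(1/3) = 1.08897
(ChristandlVranaZuiddam2021 Def 4; Q~(W) = 2^h(1/3) = 1.88988, R~(W) = 2). Record to beat: R~(cw_2)
< 3.931 (AlmanLi2026 Thm 1.3); 13/4 = route B's
BRecordThreshold. N_k = C(3k,k): 3, 15, 84, 495, 3003, 18564, 116280, 735471 (k = 1..8); DUp(k) with
R(T_k) ≤ 8^k/2 gives R~(cw_2) ≤ 4, 4.08, 3.955,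
3.858, 3.786, 3.733, 3.690, 3.657 (k = 1..8) → 3.308; record windows p/q ∈ (log(8^k/2)/log 3.931,
log_3 N_k]: k = 4: (5.570, 5.648], smallest q: 28/5;
k = 5: (7.089, 7.289], 29/4. TkMinimal known for k ≤ 4 (8^k/2 ≤ 6.75^k) and open from k = 5 (16384 >
14013). Pratt2024: under ARC k = 11 is where
Thm 1.9 beats 8^n; SCC ⇒ R~(T_k) > (8-ε)^k (Cor 1.11), R(T_k) ≥ (2/9)·8^k/k (Cor 1.12); 1.0889 < 4/3
keeps SCC consistent with omega = 2.

DEFINITION REQUESTS. (1) `tripartitionTensor k` (Pratt2024 Def 1.4) in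
Literature/Computability/AlgebraicComplexity with the lemmas "= weight-(k,k,k) zeroing of
(cwTensor K 1)^(⊠3k)", tightness, Q~ = C(3k,k), R ≤ 8^k/2 — the route inlines it meanwhile. (2)
Named facts: the Set Cover Conjecture (Pratt2024
Conj 1.2 = Cygan et al.) in Literature/Computability/FineGrained, and Pratt2024 Thm 1.9 / Cor 1.11
(SCC ⇒ R~(T_k) > (8-ε)^k eventually) — SccPrice
carries the conclusion as a hypothesis until then. Filed with `ledger workitem add --kind
definition/cite` right after open.

Novelty: Searches (2026-08-15): `lit search` local/hybrid — searchd down (connection reset, 2 tries); `lit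
search --source arxiv|openalex|s2` — HTTP 429;
`lit search --source zbmath "asymptotic rank conjecture set cover"` (7 rows: Kaski–Michalek
arXiv:2404.06427 the only relevant); `--source crossref`
(10 rows: Pratt doi:10.1145/3618260.3649620, Björklund–Kaski doi:10.1145/3618260.3649656); `lit
galaxy search "asymptotic rank conjecture" --star all`
(2 pdf hits: Michalek–Landsberg hay-in-haystack ToC 2025, CGLVW geometric ARC); `lit galaxy search
"set cover conjecture" --star all` (1 irrelevant);
`lit vsearch` (degraded, 1 irrelevant doc); `lit frontier MatrixMultiplication --since 2023` (30
rows; read arXiv:2601.08119 census — generic formats only;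
noted arXiv:2601.21553 support = quantum functionals); `lit read arXiv:2311.02774` pp. 3–5 and `lit
read arXiv:2404.06427` pp. 2, 4, 6, 9, 11, 12.
Nearest prior art found: Pratt2024 = arXiv:2311.02774 (T_k, Thm 1.9, Cor 1.11–1.12, remark T_1 =
CW's tensor and "no conflict" with R~(T_1) = 3);
BjorklundKaski2024; Kaski–Michalek arXiv:2404.06427 (cw_2 = T(g), Ex. 11, and T_k are
composition-basis tensors of W-powers; universal sequences
U_Δ, Thm 4; win-win Cor 21) — none compares T_k with cw_2-powers beyond the rate-1 zeroing, states
"SCC ⇒ R~(cw_2) ≥ 3.3085", or the k = 4 record window.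
Delta: the entropy-rate comparison of two members of one Kaski–Michalek family, read as a host
transfer R~(cw_2) ≤ 3^(i(host)) — giving at once a
record inst  [refs: 10.1145/3618260.3649620, 10.1145/3618260.3649656, 2404.06427, 2601.08119, 2601.21553, 2311.02774, doi:10.1145/3618260.3649620, doi:10.1145/3618260.3649656, Pratt2024, BjorklundKaski2024]

Barriers (technique_class: fixed-intermediate-tensor,degeneration,fine-grained-bridge): - technique_class: fixed-intermediate-tensor, degeneration, fine-grained-bridge
- Literature.Barriers.MatrixMultiplication.IrreversibilityBarrier: APPLIES to the host-transfer
mechanism and is the route's own bookkeeping: through a host s the certified bound is R~(cw_2) ≤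
3^(i(s)) (CVZ2021 Def 4 / Thm 9 logic), so the irreversible host W (i = 1.0889) caps DUpW at 3.3085
and can never give omega = 2; the positive assembly evades it only through evasions_known (i): a
FAMILY of hosts T_k with i(T_k) → 1, which is precisely crux TkMinimal (and SCC says the family
stays irreversible, i(T_k) → 1.0889). For the final step cw_2 → omega the catalogue's evasion (ii)
applies verbatim (CVZ Rem 20: bound = 2 at q = 2).
- Literature.Barriers.MatrixMultiplication.UniversalMethodBarrier: not met: no power of a CW tensor
is degenerated into matrix products here except inside the PROVED CW90 glue at q = 2, where
Alman2021 §4.2 lists cw_2 as unobstructed (omega_u bound = 2); T_k and W are never used as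
Universal-Method intermediates.
- Literature.Barriers.MatrixMultiplication.UnstableTensorBarrier: not met: cw_2, W-powers' balanced
layers T_k are semistable (uniform marginals realised by the tensor itself, moment polytope contains
the barycentre), outside BlaserLysikov2020's unstable/minimal-border-rank class; W itself is
unstable but is only a host for the record crux DUpW, whose ceiling 3.3085 is stated, not a route to
omega = 2.
- Literature.Barriers.MatrixMultiplication.InfimumNotMinimumBar

Novelty grade: new-combination — ROUTE REVIEW (refuter rreview-063f8436, 2026-08-15) VERDICT keep open. File rev 1; 12/12 decls elaborate by import (W3.lean rc0 + decide witnesses); stamped before me by g40-38/g40-31 — my pass is confirmatory with additions on 6568/6569/6571/6572/6575. (1) LOGIC: DUp ∧ TkMinimal ⇒ ∀φ φ(cw_2) ≤ 3 =  (refuter refuter-rreview-route-CriticalPhenomena--063f8436-0, 2026-08-15T14:02:57Z; prior: arXiv:2311.02774,doi:10.1145/3618260.3649656,arXiv:2404.06427,arXiv:1909.04785,arXiv:1812.06952,arXiv:2601.21553)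

History (route lifecycle, newest last):
- 2026-08-22T18:31:10Z · DORMANT — reconciler: no traction for 5.6 d (last activity item-evidence-added at 2026-08-17T04:22:18Z); parked, not closed — `ledger route dormant route-MatrixMultiplica (operator:999:458176)

sub-problem: MatrixMultiplication · status: dormant · opened planner-plancard-MatrixMultiplication-MatrixM-1b44ef5d-0 2026-08-15T11:48:17Z · rev 2 · ledger route-MatrixMultiplication-TripartitionBridge
GENERATED by the gate from the ledger (D-0016/17). Provers cite these decls: `theorem foo : Summit.MatrixMultiplication.MatrixMultiplication.Theses.TripartitionBridge.<Decl> := …` in Summits/MatrixMultiplication/MatrixMultiplication/Theorems/<Name>.lean.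
-/

namespace Summit.MatrixMultiplication.MatrixMultiplication.Theses.TripartitionBridge

open scoped BigOperators Topology Manifold Classical MeasureTheory ProbabilityTheory Matrix InnerProductSpace ComplexConjugate ContinuousMap
open Filter Set Function TopologicalSpace MeasureTheory

attribute [summit_statement] _root_.MatrixMultiplication

/-- item stmt-MatrixMultiplication-6568 · crux · rank 2 · open · by planner
why it might fail: Needs an asymptotic degeneration invisible to all known spectral points: if some universal spectral point is dark at cw_2 (φ(cw_2) > 3, i.e. R~(cw_2) > 3 = ¬BThesis) DUp fails for every k ≥ 2; nothing beyond the rate-1 zeroing T_k ≥ cw_2^k is known.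
sources: Pratt2024, arXiv:2311.02774, ChristandlVranaZuiddam2023, Strassen1988, Strassen1991, AlmanLi2026
[crux] Card item D-up. For all k, p, q with 3^p ≤ C(3k,k)^q, cw_2^(⊠p) ≲ T_k^(⊠q) in Strassen's
asymptotic preorder on `TensorClass ℂ` (there is a subexponential f with (cw_2^p)^N ≤
f(N)·(T_k^q)^N, ≤ = restriction). Equivalent (spectral theorem, in tree) to: every universal
spectral point φ has φ(cw_2) ≤ 3^(log φ(T_k)/log C(3k,k)). Known: the rate-1 zeroing T_k ≥
cw_2^(⊠k); BThesis ⇒ DUp; DUp(k) ⇒ R~(cw_2) ≤ R~(T_k)^(1/log_3 C(3k,k)) (k = 4 with R(T_4) ≤ 2048: ≤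
3.86 < 3.931; k → ∞ with 8^k: 3.3085). [difficulty: XL] -/
@[route_item "route-MatrixMultiplication-TripartitionBridge", crux]
def DUp : Prop :=
  ∀ k p q : ℕ, 3 ^ p ≤ (Nat.choose (3 * k) k) ^ q → Literature.Computability.AlgebraicComplexity.AsympLe (fun x y : Literature.Computability.AlgebraicComplexity.TensorClass ℂ => x ≤ y) ((Literature.Computability.AlgebraicComplexity.TensorClass.mk (Literature.Computability.AlgebraicComplexity.cwTensor ℂ 2)) ^ p) ((Literature.Computability.AlgebraicComplexity.TensorClass.mk (fun S T U : {A : Finset (Fin (3 * k)) // A.card = k} => if Disjoint S.1 T.1 ∧ Disjoint S.1 U.1 ∧ Disjoint T.1 U.1 then (1 : ℂ) else 0)) ^ q)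

/-- item stmt-MatrixMultiplication-6569 · crux · rank 3 · open · by planner
why it might fail: SCC forbids it: Pratt2024 Cor 1.11 gives R~(T_k) > (8-ε)^k for all large k under the Set Cover Conjecture; unconditionally only R(T_k) ≤ 8^k/2 is known (so the bound holds for k ≤ 4, as 8^k/2 ≤ (27/4)^k there, and is open from k = 5).
sources: Pratt2024, arXiv:2311.02774, BjorklundKaski2024, arXiv:2404.06427, Strassen1988
[crux] Card fact/upper side. The balanced tripartition tensors are asymptotically minimal along a
subsequence: for every δ > 0 and k0 there is k ≥ k0 with R~(T_k) ≤ (27/4 + δ)^k, i.e. lim inf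
R~(T_k)^(1/k) = 27/4 (the flattening lower bound is C(3k,k) = (27/4)^(k(1-o(1)))). Implied by
Strassen's asymptotic rank conjecture for the tight concise T_k; it is the reversibility i(T_k) → 1
that the positive assembly needs, and it refutes the Set Cover Conjecture (contrapositive of
Pratt2024 Cor 1.11, via Thm 1.9's (R~(T_k)+ε)·27^k/(C(3k,k)C(2k,k)))^(n/k) tripartitioning
algorithm). [difficulty: open-problem] -/
@[route_item "route-MatrixMultiplication-TripartitionBridge", crux]
def TkMinimal : Prop :=
  ∀ δ : ℝ, 0 < δ → ∀ k₀ : ℕ, ∃ k : ℕ, k₀ ≤ k ∧ Literature.Computability.AlgebraicComplexity.asymptoticRank (fun S T U : {A : Finset (Fin (3 * k)) // A.card = k} => if Disjoint S.1 T.1 ∧ Disjoint S.1 U.1 ∧ Disjoint T.1 U.1 then (1 : ℂ) else 0) ≤ ((27 : ℝ) / 4 + δ) ^ k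

/-- item stmt-MatrixMultiplication-6570 · crux · rank 4 · open · by planner
why it might fail: ¬DDown(k) is exactly a universal spectral point exceeding C(3k,k) at T_k (ARC false at T_k), which SCC believers expect (R~(T_k) ≈ 8^k forces dark points at T_k); and DDown ∧ SCC ∧ BThesis is contradictory, so one of three widely held expectations dies here.
sources: Pratt2024, arXiv:2311.02774, Strassen1988, ChristandlVranaZuiddam2023, arXiv:2601.21553, BjorklundKaski2024
[crux] Card item D-down (negative side; staffed for the SCC price). For all k, p, q with C(3k,k)^q ≤
3^p, T_k^(⊠q) ≲ cw_2^(⊠p) asymptotically. Equivalent to: every universal spectral point has φ(T_k) ≤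
C(3k,k)^(log_3 φ(cw_2)); since φ(cw_2) ≥ Q~(cw_2) = 3, ¬DDown(k) exhibits φ(T_k) > C(3k,k) = dim,
i.e. the first counterexample (tight, concise) to Strassen's asymptotic rank conjecture. With
SccPrice: DDown ∧ [R~(T_k) > (8-ε)^k eventually] ⇒ R~(cw_2) ≥ 8^(1/kappa) = 3.3085 > 13/4 > 3,
refuting BThesis and BRecordThreshold of route AsymptoticRankCW under SCC. [difficulty: XL] -/
@[route_item "route-MatrixMultiplication-TripartitionBridge"]
def DDown : Prop :=
  ∀ k p q : ℕ, (Nat.choose (3 * k) k) ^ q ≤ 3 ^ p → Literature.Computability.AlgebraicComplexity.AsympLe (fun x y : Literature.Computability.AlgebraicComplexity.TensorClass ℂ => x ≤ y) ((Literature.Computability.AlgebraicComplexity.TensorClass.mk (fun S T U : {A : Finset (Fin (3 * k)) // A.card = k} => if Disjoint S.1 T.1 ∧ Disjoint S.1 U.1 ∧ Disjoint T.1 U.1 then (1 : ℂ) else 0)) ^ q) ((Literature.Computability.AlgebraicComplexity.TensorClass.mk (Literature.Computability.AlgebraicComplexity.cwTensor ℂ 2)) ^ p)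

/-- item stmt-MatrixMultiplication-6571 · crux · rank 5 · open · by planner
why it might fail: Same darkness obstruction as DUp (any φ(cw_2) > 3 kills it at large r); it asks for kappa = 1.738 times the only known (zeroing) rate, and for the 2x2x2 host W every asymptotic restriction to date is a zeroing or a laser-type monomial degeneration.
sources: ChristandlVranaZuiddam2021, ChristandlVranaZuiddam2023, AlmanLi2026, arXiv:2605.21738, Zuiddam2018
[crux] The W-host form of D-up (weakest statement with the record payoff): for all p, r with
27^p·4^r ≤ 27^r (i.e. 3^p ≤ Q~(W)^r = (27/4)^(r/3)), cw_2^(⊠p) ≲ W^(⊠r), W = cwTensor ℂ 1. Known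
only at rate p/r = 1/3 (cw_2^(⊠k) is the weight-(k,k,k)-transversal zeroing of W^(⊠3k)); asked at
rate kappa/3 = 0.5794. BThesis ⇒ DUpW ⇒ R~(cw_2) ≤ 2^(3/kappa) = 3.3085 (GlueRecord); ¬DUpW ⇒ a
spectral point with φ(cw_2) > 3 ⇒ ¬BThesis. Host W is irreversible (i(W) = log 8/log(27/4) =
1.0889), so this crux can never certify omega = 2 — it is the record/kill instrument. [difficulty:
XL] -/
@[route_item "route-MatrixMultiplication-TripartitionBridge"]
def DUpW : Prop :=
  ∀ p r : ℕ, 27 ^ p * 4 ^ r ≤ 27 ^ r → Literature.Computability.AlgebraicComplexity.AsympLe (fun x y : Literature.Computability.AlgebraicComplexity.TensorClass ℂ => x ≤ y) ((Literature.Computability.AlgebraicComplexity.TensorClass.mk (Literature.Computability.AlgebraicComplexity.cwTensor ℂ 2)) ^ p) ((Literature.Computability.AlgebraicComplexity.TensorClass.mk (Literature.Computability.AlgebraicComplexity.cwTensor ℂ 1)) ^ r)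

/-- item stmt-MatrixMultiplication-6572 · crux · rank 6 · open · by planner
why it might fail: Single-shot with no slack (84 vs 81 = 3^4): orbit-closure invariants may obstruct although the asymptotic DUp holds (cf. bR(cw_2^⊠2) = 16 multiplicative, ConnerHuangLandsberg2020); e.g. bR(T_3) < bR(cw_2^⊠4) (≥ 3^4+2^4-1 = 96, CGLV Thm 1.2) would kill it — bR(T_3) ≤ 256 is all that is known.
sources: Pratt2024, ConnerGesmundoLandsbergVentura2022, ConnerHuangLandsberg2020, Alman2021
[crux] Card computation item (least non-trivial single-shot instance): T_3 (dimension C(9,3) = 84)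
degenerates (Alman's polynomial degeneration `PolyDegeneratesTo`, formats may differ) to cw_2^(⊠4)
(dimension 81). (k, m) = (3, 4) is the first pair with m > k allowed by flattening rank (k = 2: 15 <
27); a combinatorial/toric solution is a finite search (kit SAT/LP over maps [81] → C([9],3)), and
any solution tensorises to the rate-4/3 instance of DUp. [difficulty: L] -/
@[route_item "route-MatrixMultiplication-TripartitionBridge"]
def FirstLayerDegeneration : Prop :=
  Literature.Barriers.MatrixMultiplication.PolyDegeneratesTo (fun S T U : {A : Finset (Fin 9) // A.card = 3} => if Disjoint S.1 T.1 ∧ Disjoint S.1 U.1 ∧ Disjoint T.1 U.1 then (1 : ℂ) else 0) (Literature.Computability.AlgebraicComplexity.kroneckerPow (Literature.Computability.AlgebraicComplexity.cwTensor ℂ 2) 4)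

/-- item stmt-MatrixMultiplication-0589 · support · rank 9 · closed · proved by Summit.MatrixMultiplication.MatrixMultiplication.Theorems.cwPointAssembly_proof @ 373a1da5ead4 (prover) · by planner
sources: CoppersmithWinograd1990, Blaser2013, ConnerGesmundoLandsbergVentura2022
X_B → ω(ℂ) = 2: Coppersmith–Winograd 1990 easy construction via the laser method with asymptotic
rank in place of border rank: ω ≤ log_q(4·R~(T_cw,q)^3/27), q = 2 (Blaser2013 §9.2 p46–47;
ConnerGesmundoLandsbergVentura2022 = arXiv:1909.04785 Thm 1.1 + BCS Ex. 15.24). Substantial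
Literature theorem (τ-theorem Blaser2013 Thm 7.5, Thm 9.6); expect re-filing as (h : Fact) → …. -/
@[route_item "route-MatrixMultiplication-TripartitionBridge", crux]
def GlueCW90 : Prop :=
  (∀ ε : ℝ, 0 < ε → (fun N : ℕ => (Literature.Computability.AlgebraicComplexity.tensorRank (K := ℂ) (fun a b c : Fin N → Fin 3 => ∏ i, (if (a i = 0 ∧ b i = c i ∧ b i ≠ 0) ∨ (b i = 0 ∧ a i = c i ∧ a i ≠ 0) ∨ (c i = 0 ∧ a i = b i ∧ a i ≠ 0) then (1 : ℂ) else 0)) : ℝ)) =O[Filter.atTop] fun N : ℕ => (3 : ℝ) ^ ((1 + ε) * N)) → MatrixMultiplication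

/-- `GlueCW90` holds: proved by `Summit.MatrixMultiplication.MatrixMultiplication.Theorems.cwPointAssembly_proof` @ 373a1da5ead4. -/
theorem GlueCW90_holds : GlueCW90 := _root_.Summit.MatrixMultiplication.MatrixMultiplication.Theorems.cwPointAssembly_proof

/-- item stmt-MatrixMultiplication-6573 · support · rank 9 · open · by planner
sources: Pratt2024, arXiv:2404.06427, ConnerGesmundoLandsbergVentura2022
[support] Over ℂ the small Coppersmith–Winograd tensor and Pratt's T_1 (the S_3 permutation tensor)
have the same class in `TensorClass ℂ` (mutual restriction; in fact GL-equivalent via e_1 ± i·e_2 in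
each factor: x_0(y_1 z_1 + y_2 z_2) + … = (1/2)·Σ_σ X_σ(1) Y_σ(2) Z_σ(3)). Pratt2024 §1.2 remark
("T_1 arose in work of Coppersmith and Winograd"); arXiv:2404.06427 Ex. 11. Lets every prover
replace cw_2 by T_1 and work inside W-powers. [difficulty: provable-now] -/
@[route_item "route-MatrixMultiplication-TripartitionBridge"]
def CwTwoIsTOne : Prop :=
  Literature.Computability.AlgebraicComplexity.TensorClass.mk (Literature.Computability.AlgebraicComplexity.cwTensor ℂ 2) = Literature.Computability.AlgebraicComplexity.TensorClass.mk (fun S T U : {A : Finset (Fin 3) // A.card = 1} => if Disjoint S.1 T.1 ∧ Disjoint S.1 U.1 ∧ Disjoint T.1 U.1 then (1 : ℂ) else 0)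

/-- item stmt-MatrixMultiplication-6574 · support · rank 9 · open · by planner
sources: Strassen1988, Zuiddam2018, Pratt2024
[support] Positive glue: DUp → TkMinimal → BThesis (route AsymptoticRankCW's target, signature
verbatim: R(cw_2^(⊗N)) = O(3^((1+ε)N))). Proof sketch: DUp(k,p,q) and monotonicity/multiplicativity
of R~ on `TensorClass` (`asympRankOf_mk`, `asympRankOf_mono_of_asympLe`) give R~(cw_2)^p ≤ R~(T_k)^q
for 3^p ≤ C(3k,k)^q, hence R~(cw_2) ≤ R~(T_k)^(1/log_3 C(3k,k)); TkMinimal and C(3k,k) ≥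
(27/4)^k/(3k+1) give R~(cw_2) ≤ 3; then inf-form → growth form (Fekete, as in route B's BPerm3Form
ingredients). [difficulty: M] -/
@[route_item "route-MatrixMultiplication-TripartitionBridge", crux]
def GlueOmega : Prop :=
  DUp → TkMinimal → (∀ ε : ℝ, 0 < ε → (fun N : ℕ => (Literature.Computability.AlgebraicComplexity.tensorRank (K := ℂ) (fun a b c : Fin N → Fin 3 => ∏ i, (if (a i = 0 ∧ b i = c i ∧ b i ≠ 0) ∨ (b i = 0 ∧ a i = c i ∧ a i ≠ 0) ∨ (c i = 0 ∧ a i = b i ∧ a i ≠ 0) then (1 : ℂ) else 0)) : ℝ)) =O[Filter.atTop] fun N : ℕ => (3 : ℝ) ^ ((1 + ε) * N))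

/-- item stmt-MatrixMultiplication-6575 · support · rank 9 · open · by planner
sources: AlmanLi2026, arXiv:2605.21738, ChristandlVranaZuiddam2021, Blaser2013
[support] Record payoff of the W-host crux: DUpW → R~(cw_2) ≤ 331/100 (exact constant 2^(3/kappa) =
8^(log 3/log(27/4)) = 3.30805 < 3.31 < 3.931 = AlmanLi2026 Thm 1.3). Uses R~(W) ≤ 2 (bR(W) = 2 +
Bini, `SchoenhageTauBini`), multiplicativity R~(t^(⊠r)) = R~(t)^r and monotonicity of R~ under ≲ on
`TensorClass ℂ`. [difficulty: M] -/
@[route_item "route-MatrixMultiplication-TripartitionBridge"]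
def GlueRecord : Prop :=
  DUpW → Literature.Computability.AlgebraicComplexity.asymptoticRank (Literature.Computability.AlgebraicComplexity.cwTensor ℂ 2) ≤ 331 / 100

/-- item stmt-MatrixMultiplication-6576 · support · rank 9 · open · by planner
sources: Pratt2024, AlmanLi2026, arXiv:2605.21738
[support] The smallest record window: if R(T_4) ≤ 2048 (Pratt2024 §1.2: R(T_k) ≤ 8^k/2 via the
structure tensor of Z_2^(3k-1), char ≠ 2) and the single DUp instance (k, p, q) = (4, 28, 5) holds
(3^28 = 2.29e13 ≤ 495^5 = 2.97e13), then R~(cw_2) ≤ 2048^(5/28) = 3.9022 ≤ 393/100 < 3.931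
(AlmanLi2026). Documents that ONE asymptotic restriction T_4^(⊠5) ≳ cw_2^(⊠28) between explicit
tensors beats the current record. [difficulty: M] -/
@[route_item "route-MatrixMultiplication-TripartitionBridge"]
def RecordWindowK4 : Prop :=
  Literature.Computability.AlgebraicComplexity.tensorRank (K := ℂ) (fun S T U : {A : Finset (Fin 12) // A.card = 4} => if Disjoint S.1 T.1 ∧ Disjoint S.1 U.1 ∧ Disjoint T.1 U.1 then (1 : ℂ) else 0) ≤ 2048 → Literature.Computability.AlgebraicComplexity.AsympLe (fun x y : Literature.Computability.AlgebraicComplexity.TensorClass ℂ => x ≤ y) ((Literature.Computability.AlgebraicComplexity.TensorClass.mk (Literature.Computability.AlgebraicComplexity.cwTensor ℂ 2)) ^ 28) ((Literature.Computability.AlgebraicComplexity.TensorClass.mk (fun S T U : {A : Finset (Fin 12) // A.card = 4} => if Disjoint S.1 T.1 ∧ Disjoint S.1 U.1 ∧ Disjoint T.1 U.1 then (1 : ℂ) else 0)) ^ 5) → Literature.Computability.AlgebraicComplexity.asymptoticRank (Literature.Computability.AlgebraicComplexity.cwTensor ℂ 2) ≤ 393 / 100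

/-- item stmt-MatrixMultiplication-6577 · support · rank 9 · open · by planner
sources: Pratt2024, arXiv:2311.02774, BjorklundKaski2024
[support] Negative glue (the SCC price tag of route AsymptoticRankCW): DDown → [Pratt2024 Cor 1.11's
conclusion, taken as hypothesis until SCC and Pratt's theorem are vendored: ∀ ε > 0, eventually
R~(T_k) > (8-ε)^k] → ¬BThesis. Proof sketch: DDown(k,p,q) gives R~(T_k)^q ≤ R~(cw_2)^p for C(3k,k)^q
≤ 3^p, so R~(T_k) ≤ R~(cw_2)^(log_3 C(3k,k)) ≤ R~(cw_2)^(kappa·k); with the hypothesis R~(cw_2) ≥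
(8-ε)^(1/kappa) → 3.3085 > 3, while BThesis gives R~(cw_2) ≤ 3. [difficulty: M] -/
@[route_item "route-MatrixMultiplication-TripartitionBridge"]
def SccPrice : Prop :=
  DDown → (∀ ε : ℝ, 0 < ε → ∃ k₀ : ℕ, ∀ k : ℕ, k₀ ≤ k → ((8 : ℝ) - ε) ^ k < Literature.Computability.AlgebraicComplexity.asymptoticRank (fun S T U : {A : Finset (Fin (3 * k)) // A.card = k} => if Disjoint S.1 T.1 ∧ Disjoint S.1 U.1 ∧ Disjoint T.1 U.1 then (1 : ℂ) else 0)) → ¬ (∀ ε : ℝ, 0 < ε → (fun N : ℕ => (Literature.Computability.AlgebraicComplexity.tensorRank (K := ℂ) (fun a b c : Fin N → Fin 3 => ∏ i, (if (a i = 0 ∧ b i = c i ∧ b i ≠ 0) ∨ (b i = 0 ∧ a i = c i ∧ a i ≠ 0) ∨ (c i = 0 ∧ a i = b i ∧ a i ≠ 0) then (1 : ℂ) else 0)) : ℝ)) =O[Filter.atTop] fun N : ℕ => (3 : ℝ) ^ ((1 + ε) * N))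

/-- item stmt-MatrixMultiplication-6578 · assembly · rank 1 · open · by planner
sources: CoppersmithWinograd1990, Pratt2024, Strassen1988
[assembly] DUp → TkMinimal → omega(ℂ) = 2 (via GlueOmega and GlueCW90). -/
@[route_item "route-MatrixMultiplication-TripartitionBridge"]
def Assembly : Prop :=
  DUp → TkMinimal → MatrixMultiplication

/-! D-0027 §2.1 — DECIDING THEOREM (planner-authored via `route open/edit --closes-file`; by planner-rbadge-MatrixMultiplication-Tripartiti-f350c0d8-g2-0 2026-08-15T16:11:15Z):
its hypotheses are this route's items and its conclusion the sub-problem Statement (glue_lint), and it elaborates with this file. -/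

/-- Route glue (D-0027 §2.1): the two cruxes `DUp` (host transfer `cw_2^p ≲ T_k^q` at the
entropy-matching rate `3^p ≤ C(3k,k)^q`) and `TkMinimal` (`lim inf R~(T_k)^(1/k) = 27/4`) give
route B's thesis `R(cw_2^(⊠N)) = O(3^((1+ε)N))` through the support item `GlueOmega`
(host transfer + reversibility of the host), and the support item `GlueCW90`
(Coppersmith–Winograd 1990 in asymptotic-rank form, `q = 2`, `ρ = 3`) turns that into `ω(ℂ) = 2`.
Pure composition of the two glue items; the mathematics lives in the four hypotheses. -/
@[closes "route-MatrixMultiplication-TripartitionBridge"] theorem closes : DUp → TkMinimal → GlueOmega → GlueCW90 → MatrixMultiplication :=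
  fun hUp hTk hOmega hCW => hCW (hOmega hUp hTk)

end Summit.MatrixMultiplication.MatrixMultiplication.Theses.TripartitionBridge
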